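import Summits.AtomisticToContinuum.FouriersLaw.Theorems.BondHeatUncertaintySubdiffusiveBondHeatJunctionRatioSmoothResponse
import Summits.AtomisticToContinuum.FouriersLaw.Theorems.BondHeatUncertaintySubdiffusiveBondHeatJunctionRatioTransferMoment

/-!
# `JunctionRatioResponseRegularityProof` — file 25b of the junction-ratio programme: **[RR] PROVED**
# (`responseRegularity_holds : ResponseRegularity`)

Route `BondHeatUncertainty`, residual `BoundedResponse` (stmt-AtomisticToContinuum-11071), door
`boundedResponse_of_bracket_of_peeled_of_escapeInfZero_of_subOhmicBootstrap'` (file 21f), leaf **[RR]**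
`EscapeGrading.ResponseRegularity` (file 19a): at every `N ≥ 3` a response density `h`, tap scores
`g_0, g_{N−1} ∈ L²(μ_T)` at the two contact sites and depth-two moment coefficients `τ_1, τ_{N−2}`.

Proof.  Take the SMOOTH density of file 25a, `h = (γ/2T²) v∘Θ` with `L_{T,T} v = −(p_0² − p_{N−1}²)`,
`|v| ≤ K e^{ϑH}` (`exists_smoothResponseDensity`).
* `h` is a response density (`isResponseDensityAt_of_weighted`: the weighted linear response along the
  canonical steady family, weak-NESS uniqueness `bondHeatUncertainty_nessUnique_holds`, and `C_c^∞ ⊂` the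
  weighted `C²` class, `testFunction_bound`);
* **tap scores** (`isTapScoreAt_of_contDiff`): for a `C¹` density with `∂_{p_b} h ∈ L²(μ_T)` the function
  `g_b = ∂_{p_b} h − a p_b` is a tap score — the defining identity is the Gibbs integration by parts
  `∫ p_b F e^{-H/T} = T ∫ ∂_{p_b}F e^{-H/T}` (23a) with `F = h φ`; and `∂_{p_b} h ∈ L²(μ_T)` at the CONTACT sites
  because `v` is a Poisson solution in `C² ∩ L²(μ_T)` with an `L²` source, so it has finite Dirichlet energy at
  every thermostatted site (the tree's `OddSectorIrreversibility.Corrector.memLp_partialP_of_poisson`, i.e. the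
  carré-du-champ/energy-cutoff estimate `SuperadditiveResistance.Kubo.memLp_partialP`), transported through the
  momentum flip (`partialP_comp_flip`, `memLp_two_comp_flip`);
* **moment coefficients** exist at EVERY site (`exists_momentCoefficientAt`: `τ_i = ∫ p_i² h̃ dμ_T` from the
  weighted response of 24b with `φ = p_i²` and NESS uniqueness).

Main results: `responseRegularityAt_holds`, `responseRegularity_holds : ResponseRegularity`, and the door of
record with [BI] (24e) and [RR] discharged:
`boundedResponse_of_peeled_of_entropy_of_escapeInfZero_of_subOhmicBootstrap :
  (∀ ρ < 1, PeeledLocalityLaw ρ 1) → FirstOrderEntropyProduction → EscapeInfZero → SubOhmicBootstrap → BoundedResponse`.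
No definitions; all theorems fully proved; standard axioms.  References: Eckmann–Pillet–Rey-Bellet 1999 §3;
Cuneo–Eckmann–Hairer–Rey-Bellet 2018; folklore.
-/

noncomputable section

open MeasureTheory ProbabilityTheory Filter Topology Set
open scoped NNReal ENNReal ContDiff

namespace Summit.AtomisticToContinuum.FouriersLaw.Theorems.SubdiffusiveBondHeat.EscapeGrading

open Literature.MathematicalPhysics.KineticTheory.HeatConduction
open Literature.Probability.Process Literature.MathematicalPhysics.KineticTheory OscillatorChain
open Summit.AtomisticToContinuum.FouriersLaw.Theses.BondHeatUncertainty (BoundedResponse)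
open Summit.AtomisticToContinuum.FouriersLaw.Theorems.SubdiffusiveBondHeat.JunctionDefectGrading

variable {N : ℕ}

/-! ## A. Momentum-flip calculus -/

/-- **`Θ`-invariance of `L²(μ_T)`** for continuous functions: `f ∈ L²(μ_T) ⟹ f∘Θ ∈ L²(μ_T)` (`Θ` preserves
Lebesgue measure and `H∘Θ = H`). [folklore] -/
theorem memLp_two_comp_flip {ω₂ lam β : ℝ} (hω : 0 < ω₂) (hl : 0 ≤ lam) (hβ : 0 ≤ β) (γ : ℝ) {T : ℝ}
    (hT : 0 < T) {f : PhaseSpace N → ℝ} (hfc : Continuous f)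
    (hf : MemLp f 2 ((pinnedChain ω₂ lam β γ).gibbsMeasure N T)) :
    MemLp (fun x : PhaseSpace N => f (x.1, -x.2)) 2 ((pinnedChain ω₂ lam β γ).gibbsMeasure N T) := by
  have h1 : Integrable (fun x => f x ^ 2 * (pinnedChain ω₂ lam β γ).gibbsDensity N T x) :=
    SuperadditiveResistance.Kubo.integrable_sq_mul_gibbsDensity hω hl hβ γ N hT hf
  have h2 : Integrable (fun x : PhaseSpace N =>
      f (x.1, -x.2) ^ 2 * (pinnedChain ω₂ lam β γ).gibbsDensity N T x) := by
    refine ((measurePreserving_momentumReversal N).integrable_comp_of_integrable h1).congr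
      (ae_of_all _ fun x => ?_)
    simp only [Function.comp_apply, momentumReversal_apply, OscillatorChain.gibbsDensity,
      (pinnedChain ω₂ lam β γ).hamiltonian_neg_momentum N x]
  exact SuperadditiveResistance.Kubo.memLp_of_integrable_sq_mul_gibbsDensity hω hl hβ γ N hT
    (hfc.comp (continuous_fst.prodMk continuous_snd.neg)) h2

/-! ## B. Contact sites are thermostatted -/

/-- The bath weight of a contact site (`b = 0` or `b = N − 1`) is positive, so that the tree's finite-entropy-
production lemma `OddSectorIrreversibility.Corrector.memLp_partialP_of_poisson` (`∂_{p_b}` of a `C² ∩ L²(μ_T)`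
Poisson solution with `L²` source is in `L²(μ_T)` at every thermostatted site) applies there. [folklore] -/
theorem bathWeight_pos_of_contact {b : Fin N} (hb : b.val = 0 ∨ b.val = N - 1) :
    0 < OscillatorChain.bathWeight N b := by
  unfold OscillatorChain.bathWeight
  rcases hb with h | h
  · rw [if_pos h]; split_ifs <;> norm_num
  · rw [if_pos h]; split_ifs <;> norm_num

/-! ## C. From the weighted linear response to `IsResponseDensityAt` and to moment coefficients -/

/-- **A weighted-response density is a response density.**  If `h ∈ L²(μ_T)` represents the linear response
of the steady states on the weighted class `{φ ∈ C² : |φ| ≤ C e^{ϑH}}` (`ϑ ≥ 0`) along every steady family, then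
`IsResponseDensityAt … h` (test functions are in the weighted class, `testFunction_bound`; the two-sided limit
along the canonical family gives the one-sided expansion at every steady state by weak-NESS uniqueness).
[re-assembly of tree theorems] -/
theorem isResponseDensityAt_of_weighted {ω₂ lam β γ : ℝ} (hω : 0 < ω₂) (hl : 0 < lam) (hβ : 0 < β)
    (hγ : 0 < γ) {T : ℝ} (hT : 0 < T) {ϑ : ℝ} (hϑ : 0 ≤ ϑ) {h : PhaseSpace N → ℝ}
    (hh2 : MemLp h 2 ((pinnedChain ω₂ lam β γ).gibbsMeasure N T))
    (hW : ∀ (φ : PhaseSpace N → ℝ) (C : ℝ), ContDiff ℝ 2 φ →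
      (∀ y, |φ y| ≤ C * Real.exp (ϑ * (pinnedChain ω₂ lam β γ).hamiltonian N y)) →
      ∀ μ : ℝ → ℝ → Measure (PhaseSpace N),
        (∀ T_L T_R : ℝ, 0 < T_L → 0 < T_R →
          (pinnedChain ω₂ lam β γ).IsSteadyState N T_L T_R (μ T_L T_R)) →
        Tendsto (fun δ : ℝ => ((∫ x, φ x ∂(μ (T + δ / 2) (T - δ / 2))) -
            ∫ x, φ x ∂((pinnedChain ω₂ lam β γ).gibbsMeasure N T)) / δ)
          (𝓝[≠] 0) (𝓝 (∫ x, φ x * h x ∂((pinnedChain ω₂ lam β γ).gibbsMeasure N T)))) :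
    IsResponseDensityAt ω₂ lam β γ T N h := by
  have huniq := bondHeatUncertainty_nessUnique_holds ω₂ lam β γ hω hl hβ hγ
  obtain ⟨μf, hμf, -⟩ := exists_canonical_response hω hl hβ hγ hT
  refine ⟨hh2, fun F hFs hFc ε hε => ?_⟩
  obtain ⟨hF2, C, hC⟩ := testFunction_bound hω hl.le hβ.le γ hϑ hFs hFc (N := N)
  have hlim := hW F C hF2 hC (μf N) (hμf N)
  obtain ⟨δ₁, hδ₁, hδ₁'⟩ := Metric.tendsto_nhdsWithin_nhds.1 hlim ε hε
  refine ⟨min δ₁ T, lt_min hδ₁ hT, fun δ hδ hδlt μ hμ => ?_⟩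
  have hδ1 : δ < δ₁ := lt_of_lt_of_le hδlt (min_le_left _ _)
  have hδT : δ < T := lt_of_lt_of_le hδlt (min_le_right _ _)
  have hTL : 0 < T + δ / 2 := by linarith
  have hTR : 0 < T - δ / 2 := by linarith
  have hμeq : μ = μf N (T + δ / 2) (T - δ / 2) := huniq N _ _ hTL hTR μ _ hμ (hμf N _ _ hTL hTR)
  have hmem : δ ∈ ({0}ᶜ : Set ℝ) := by simp [hδ.ne']
  have hdd : dist δ 0 < δ₁ := by rw [Real.dist_eq, sub_zero, abs_of_pos hδ]; exact hδ1
  have hdist := hδ₁' hmem hdd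
  rw [← hμeq, Real.dist_eq] at hdist
  set A := (∫ x, F x ∂μ) - ∫ x, F x ∂((pinnedChain ω₂ lam β γ).gibbsMeasure N T) with hA
  set L := ∫ x, F x * h x ∂((pinnedChain ω₂ lam β γ).gibbsMeasure N T) with hL
  have e : A - δ * L = δ * (A / δ - L) := by field_simp
  rw [e, abs_mul, abs_of_pos hδ]
  exact mul_le_mul_of_nonneg_left hdist.le hδ.le

/-- **Moment coefficients exist at every site** (all parameters `> 0`, `T > 0`, any `i`):
`τ_i := ∫ p_i² h̃ dμ_T` with the weighted density `h̃` of 24b works, since `⟨p_i²⟩_{μ_T} = T`, `p_i²` is in the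
weighted `C²` class, and every steady state at `(T+δ/2, T−δ/2)` is the canonical one. [re-assembly of tree theorems] -/
theorem exists_momentCoefficientAt {ω₂ lam β γ : ℝ} (hω : 0 < ω₂) (hl : 0 < lam) (hβ : 0 < β)
    (hγ : 0 < γ) {T : ℝ} (hT : 0 < T) (i : Fin N) :
    ∃ τ : ℝ, IsMomentCoefficientAt ω₂ lam β γ T N i τ := by
  have hN : 0 < N := Fin.pos i
  have huniq := bondHeatUncertainty_nessUnique_holds ω₂ lam β γ hω hl hβ hγ
  obtain ⟨μf, hμf, -⟩ := exists_canonical_response hω hl hβ hγ hT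
  obtain ⟨ϑ, hϑ, hw, hw2, hW⟩ := exists_weightedResponseDensity hω hl hβ hγ hT hN
  have hp2 : ContDiff ℝ 2 fun x : PhaseSpace N => x.2 i ^ 2 := by fun_prop
  have hpt : IsTempered ω₂ lam β γ N fun x : PhaseSpace N => x.2 i ^ 2 :=
    (IsTempered.snd hω.le hl.le hβ.le i).pow 2
  obtain ⟨C, hC⟩ := hpt.abs_le_exp hω.le hl.le hβ.le hϑ
  -- `⟨p_i²⟩_{μ_T} = T`
  have hpT : ∫ x, x.2 i ^ 2 ∂((pinnedChain ω₂ lam β γ).gibbsMeasure N T) = T := by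
    have hZ : 0 < ∫ x, (pinnedChain ω₂ lam β γ).gibbsDensity N T x :=
      integral_exp_pos (pinnedChain_integrable_gibbsDensity hω hl.le hβ.le γ N hT)
    have h1 := integral_snd_sq_mul_gibbsDensity_eq hω hl.le hβ.le γ hT i (F := fun _ => (1 : ℝ))
      continuous_const (IsTempered.const 1) (fun _ _ => rfl)
    simp only [mul_one, one_mul] at h1
    rw [(pinnedChain ω₂ lam β γ).integral_gibbsMeasure, h1]
    field_simp
  refine ⟨∫ x, x.2 i ^ 2 * hw x ∂((pinnedChain ω₂ lam β γ).gibbsMeasure N T), fun ε hε => ?_⟩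
  have hlim := hW _ C hp2 hC (μf N) (hμf N)
  rw [hpT] at hlim
  obtain ⟨δ₁, hδ₁, hδ₁'⟩ := Metric.tendsto_nhdsWithin_nhds.1 hlim ε hε
  refine ⟨min δ₁ T, lt_min hδ₁ hT, fun δ hδ hδlt μ hμ => ?_⟩
  have hδ1 : δ < δ₁ := lt_of_lt_of_le hδlt (min_le_left _ _)
  have hδT : δ < T := lt_of_lt_of_le hδlt (min_le_right _ _)
  have hTL : 0 < T + δ / 2 := by linarith
  have hTR : 0 < T - δ / 2 := by linarith
  have hμeq : μ = μf N (T + δ / 2) (T - δ / 2) := huniq N _ _ hTL hTR μ _ hμ (hμf N _ _ hTL hTR)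
  have hmem : δ ∈ ({0}ᶜ : Set ℝ) := by simp [hδ.ne']
  have hdd : dist δ 0 < δ₁ := by rw [Real.dist_eq, sub_zero, abs_of_pos hδ]; exact hδ1
  have hdist := hδ₁' hmem hdd
  rw [← hμeq, Real.dist_eq] at hdist
  set A := (∫ x, x.2 i ^ 2 ∂μ) - T with hA
  set L := ∫ x, x.2 i ^ 2 * hw x ∂((pinnedChain ω₂ lam β γ).gibbsMeasure N T) with hL
  have e : (∫ x, x.2 i ^ 2 ∂μ) - T - δ * L = δ * (A / δ - L) := by rw [hA]; field_simp
  rw [e, abs_mul, abs_of_pos hδ]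
  exact mul_le_mul_of_nonneg_left hdist.le hδ.le

/-! ## D. Tap scores of a `C¹` density -/

/-- **Tap scores of a `C¹` density.**  For the pinned chain (`ω₂ > 0`, `lam, β ≥ 0`), `T > 0`, a site `b`, a
constant `a` and a `C¹` density `h` with `∂_{p_b} h ∈ L²(μ_T)`: `g_b := ∂_{p_b} h − a p_b` is a tap score,
`IsTapScoreAt … b a h g_b` — the defining identity `∫ (g_b + a p_b) φ dμ_T = ∫ h (p_b φ/T − ∂_{p_b}φ) dμ_T` is the
Gibbs integration by parts `∫ p_b (hφ) e^{-H/T} = T ∫ ∂_{p_b}(hφ) e^{-H/T}` (`integral_snd_mul_gibbsDensity_eq_partialP`,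
23a; `hφ` and `∂_{p_b}(hφ)` are compactly supported, hence tempered). [folklore] -/
theorem isTapScoreAt_of_contDiff {ω₂ lam β : ℝ} (hω : 0 < ω₂) (hl : 0 ≤ lam) (hβ : 0 ≤ β) (γ : ℝ)
    {T : ℝ} (hT : 0 < T) (b : Fin N) (a : ℝ) {h : PhaseSpace N → ℝ} (hh : ContDiff ℝ 1 h)
    (hdb : MemLp (partialP b h) 2 ((pinnedChain ω₂ lam β γ).gibbsMeasure N T)) :
    IsTapScoreAt ω₂ lam β γ T N b a h (fun x => partialP b h x - a * x.2 b) := by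
  have hpt : IsTempered ω₂ lam β γ N fun x : PhaseSpace N => x.2 b := IsTempered.snd hω.le hl hβ b
  refine ⟨hdb.sub ((hpt.memLp_two (by fun_prop) hω hl hβ hT).const_mul a), fun φ hφ hφc => ?_⟩
  simp only [sub_add_cancel]
  have hφ1 : ContDiff ℝ 1 φ := hφ.of_le (by norm_cast)
  have hρc : Continuous fun x => (pinnedChain ω₂ lam β γ).gibbsDensity N T x :=
    pinnedChain_continuous_gibbsDensity ω₂ lam β γ N T
  have hhc : Continuous h := hh.continuous
  have hdhc : Continuous (partialP b h) := continuous_partialP hh one_ne_zero b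
  have hφc' : Continuous φ := hφ1.continuous
  have hdφc : Continuous (partialP b φ) := continuous_partialP hφ1 one_ne_zero b
  have hdφs : HasCompactSupport (partialP b φ) := hasCompactSupport_partialP (hφ1.differentiable one_ne_zero) hφc b
  -- the product `F = h φ` and its momentum derivative
  have hF1 : ContDiff ℝ 1 fun x => h x * φ x := hh.mul hφ1
  have hFs : HasCompactSupport fun x => h x * φ x := hφc.mul_left
  obtain ⟨CF, hCF⟩ := hF1.continuous.bounded_above_of_compact_support hFs
  have hF : IsTempered ω₂ lam β γ N fun x => h x * φ x :=
    IsTempered.of_bounded (C := CF) fun x => by rw [← Real.norm_eq_abs]; exact hCF x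
  have hdF : partialP b (fun x => h x * φ x) = fun x => partialP b h x * φ x + h x * partialP b φ x :=
    funext fun x => SuperadditiveResistance.DeviceLiouville.partialP_mul (hh.differentiable one_ne_zero)
      (hφ1.differentiable one_ne_zero) b x
  have hdFs : HasCompactSupport (partialP b fun x => h x * φ x) :=
    hasCompactSupport_partialP (hF1.differentiable one_ne_zero) hFs b
  have hdFc : Continuous (partialP b fun x => h x * φ x) := continuous_partialP hF1 one_ne_zero b
  obtain ⟨CF', hCF'⟩ := hdFc.bounded_above_of_compact_support hdFs
  have hF' : IsTempered ω₂ lam β γ N (partialP b fun x => h x * φ x) :=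
    IsTempered.of_bounded (C := CF') fun x => by rw [← Real.norm_eq_abs]; exact hCF' x
  have hIBP := integral_snd_mul_gibbsDensity_eq_partialP hω hl hβ γ hT b hF1 hF hF'
  rw [hdF] at hIBP
  -- integrability against `e^{-H/T} dx` (compact supports)
  have hi1 : Integrable fun x => partialP b h x * φ x * (pinnedChain ω₂ lam β γ).gibbsDensity N T x :=
    ((hdhc.mul hφc').mul hρc).integrable_of_hasCompactSupport (hφc.mul_left.mul_right)
  have hi2 : Integrable fun x => h x * partialP b φ x * (pinnedChain ω₂ lam β γ).gibbsDensity N T x :=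
    ((hhc.mul hdφc).mul hρc).integrable_of_hasCompactSupport (hdφs.mul_left.mul_right)
  have hi3 : Integrable fun x => x.2 b * (h x * φ x) * (pinnedChain ω₂ lam β γ).gibbsDensity N T x :=
    ((((continuous_apply b).comp continuous_snd).mul (hhc.mul hφc')).mul hρc).integrable_of_hasCompactSupport
      (hFs.mul_left.mul_right)
  have hsum : ∫ x, (fun x => partialP b h x * φ x + h x * partialP b φ x) x *
      (pinnedChain ω₂ lam β γ).gibbsDensity N T x =
      (∫ x, partialP b h x * φ x * (pinnedChain ω₂ lam β γ).gibbsDensity N T x) +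
        ∫ x, h x * partialP b φ x * (pinnedChain ω₂ lam β γ).gibbsDensity N T x := by
    rw [← integral_add hi1 hi2]
    exact integral_congr_ae (ae_of_all _ fun x => by simp only [add_mul])
  rw [hsum] at hIBP
  -- the identity
  rw [(pinnedChain ω₂ lam β γ).integral_gibbsMeasure, (pinnedChain ω₂ lam β γ).integral_gibbsMeasure]
  congr 1
  symm
  calc ∫ x, h x * (x.2 b / T * φ x - partialP b φ x) * (pinnedChain ω₂ lam β γ).gibbsDensity N T x
      = ∫ x, (1 / T * (x.2 b * (h x * φ x) * (pinnedChain ω₂ lam β γ).gibbsDensity N T x) -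
          h x * partialP b φ x * (pinnedChain ω₂ lam β γ).gibbsDensity N T x) :=
        integral_congr_ae (ae_of_all _ fun x => by ring)
    _ = 1 / T * (∫ x, x.2 b * (h x * φ x) * (pinnedChain ω₂ lam β γ).gibbsDensity N T x) -
          ∫ x, h x * partialP b φ x * (pinnedChain ω₂ lam β γ).gibbsDensity N T x := by
        rw [integral_sub (hi3.const_mul _) hi2, integral_const_mul]
    _ = ∫ x, partialP b h x * φ x * (pinnedChain ω₂ lam β γ).gibbsDensity N T x := by
        rw [hIBP]; field_simp; ring

/-! ## E. [RR] proved -/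

/-- **[RR] at every `N`** (all parameters `> 0`, `T > 0`): `ResponseRegularityAt ω₂ lam β γ T N`.  The density is
`h = (γ/2T²) v∘Θ` of file 25a; the tap scores are `∂_{p_b} h ∓ p_b/(2T²)` (§A, §B, §D and the tree's
`OddSectorIrreversibility.Corrector.memLp_partialP_of_poisson`); the coefficients are those of §C. [this file] -/
theorem responseRegularityAt_holds {ω₂ lam β γ T : ℝ} (hω : 0 < ω₂) (hl : 0 < lam) (hβ : 0 < β)
    (hγ : 0 < γ) (hT : 0 < T) (N : ℕ) : ResponseRegularityAt ω₂ lam β γ T N := by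
  intro h3
  have hN : 0 < N := by omega
  obtain ⟨ϑ, hϑ, h2ϑ, v, hv, hLv, ⟨K, hK0, hK⟩, hW⟩ := exists_smoothResponseDensity hω hl hβ hγ hT hN
  have hv2' : ContDiff ℝ 2 v := hv.of_le (by norm_cast)
  have hv1 : ContDiff ℝ 1 v := hv.of_le (by norm_cast)
  -- `v ∈ L²(μ_T)` from `|v| ≤ K e^{ϑH}`, `2ϑ < 1/T`
  have hπ2 := pinnedChain_integrable_exp_mul_hamiltonian_gibbsMeasure hω hl.le hβ.le γ N hT h2ϑ
  have hv2 : MemLp v 2 ((pinnedChain ω₂ lam β γ).gibbsMeasure N T) := by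
    refine (memLp_two_iff_integrable_sq hv.continuous.aestronglyMeasurable).2 ?_
    refine (hπ2.const_mul (K ^ 2)).mono' (hv.continuous.pow 2).aestronglyMeasurable
      (Eventually.of_forall fun x => ?_)
    calc ‖v x ^ 2‖ = |v x| ^ 2 := by rw [Real.norm_eq_abs, abs_pow]
      _ ≤ (K * Real.exp (ϑ * (pinnedChain ω₂ lam β γ).hamiltonian N x)) ^ 2 :=
          pow_le_pow_left₀ (abs_nonneg _) (hK x) 2
      _ = K ^ 2 * Real.exp (2 * ϑ * (pinnedChain ω₂ lam β γ).hamiltonian N x) := by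
          rw [mul_pow, sq (Real.exp _), ← Real.exp_add]
          congr 1; ring
  -- the source `p_0² − p_{N−1}²` is in `L²(μ_T)`
  have hgt : IsTempered ω₂ lam β γ N fun x : PhaseSpace N => x.2 ⟨0, hN⟩ ^ 2 - x.2 ⟨N - 1, by omega⟩ ^ 2 :=
    ((IsTempered.snd hω.le hl.le hβ.le _).pow 2).sub hω.le hl.le hβ.le ((IsTempered.snd hω.le hl.le hβ.le _).pow 2)
  have hg2 : MemLp (fun x : PhaseSpace N => x.2 ⟨0, hN⟩ ^ 2 - x.2 ⟨N - 1, by omega⟩ ^ 2) 2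
      ((pinnedChain ω₂ lam β γ).gibbsMeasure N T) := hgt.memLp_two (by fun_prop) hω hl.le hβ.le hT
  -- the density `h = (γ/2T²) v∘Θ`
  have hf2 : MemLp (fun x : PhaseSpace N => γ / (2 * T ^ 2) * v (x.1, -x.2)) 2
      ((pinnedChain ω₂ lam β γ).gibbsMeasure N T) :=
    (memLp_two_comp_flip hω hl.le hβ.le γ hT hv.continuous hv2).const_mul _
  have hRD : IsResponseDensityAt ω₂ lam β γ T N fun x : PhaseSpace N => γ / (2 * T ^ 2) * v (x.1, -x.2) :=
    isResponseDensityAt_of_weighted hω hl hβ hγ hT hϑ.le hf2 hW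
  have hfC1 : ContDiff ℝ 1 fun x : PhaseSpace N => γ / (2 * T ^ 2) * v (x.1, -x.2) :=
    contDiff_const.mul (hv1.comp (contDiff_fst.prodMk contDiff_snd.neg))
  -- contact-momentum derivatives of the density are in `L²(μ_T)`
  have hdb : ∀ {b : Fin N}, (b.val = 0 ∨ b.val = N - 1) →
      MemLp (partialP b fun x : PhaseSpace N => γ / (2 * T ^ 2) * v (x.1, -x.2)) 2
        ((pinnedChain ω₂ lam β γ).gibbsMeasure N T) := by
    intro b hb
    have hdv := OddSectorIrreversibility.Corrector.memLp_partialP_of_poisson hω hl.le hβ.le hγ hT hv2' hv2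
      hg2 hLv (bathWeight_pos_of_contact hb)
    have hflip := memLp_two_comp_flip hω hl.le hβ.le γ hT (continuous_partialP hv1 one_ne_zero b) hdv
    have e : (partialP b fun x : PhaseSpace N => γ / (2 * T ^ 2) * v (x.1, -x.2)) =
        fun x => -(γ / (2 * T ^ 2)) * partialP b v (x.1, -x.2) := by
      funext x
      have partialP_comp_flip : ∀ (v : PhaseSpace N → ℝ) (b : Fin N) (x : PhaseSpace N),
          partialP b (fun y : PhaseSpace N => v (y.1, -y.2)) x = -partialP b v (x.1, -x.2) := by
        intro v b x
        simp only [partialP]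
        have hneg : ∀ t : ℝ, -Function.update x.2 b t = Function.update (-x.2) b (-t) := by
          intro t; funext j; simp only [Pi.neg_apply, Function.update_apply]; split_ifs <;> simp
        have h : (fun t : ℝ => v (x.1, -Function.update x.2 b t)) =
            fun t => (fun s : ℝ => v (x.1, Function.update (-x.2) b s)) (-t) := by
          funext t; simp only [hneg]
        rw [h]
        exact deriv_comp_neg (fun s : ℝ => v (x.1, Function.update (-x.2) b s)) (x.2 b)
      rw [partialP_const_mul, partialP_comp_flip]
      ring
    rw [e]
    exact hflip.const_mul _
  have hT0 := isTapScoreAt_of_contDiff hω hl.le hβ.le γ hT ⟨0, by omega⟩ (1 / (2 * T ^ 2)) hfC1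
    (hdb (Or.inl rfl))
  have hT1 := isTapScoreAt_of_contDiff hω hl.le hβ.le γ hT ⟨N - 1, by omega⟩ (-(1 / (2 * T ^ 2))) hfC1
    (hdb (Or.inr rfl))
  obtain ⟨τ, hτ⟩ := exists_momentCoefficientAt hω hl hβ hγ hT (⟨1, by omega⟩ : Fin N)
  obtain ⟨τ', hτ'⟩ := exists_momentCoefficientAt hω hl hβ hγ hT (⟨N - 1 - 1, by omega⟩ : Fin N)
  exact ⟨_, _, _, τ, τ', hRD, hT0, hT1, hτ, hτ'⟩

/-- **[RR] `ResponseRegularity` holds.** [this file] -/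
theorem responseRegularity_holds : ResponseRegularity :=
  fun _ _ _ _ hω hl hβ hγ _ hT N => responseRegularityAt_holds hω hl hβ hγ hT N

/-- **The door of record with [BI] (24e) and [RR] (this file) discharged:**
`(∀ ρ < 1, PeeledLocalityLaw ρ 1) ∧ EP ∧ EscapeInfZero ∧ SubOhmicBootstrap ⟹ BoundedResponse` (item 11071 by
name; door `boundedResponse_of_bracket_of_peeled_of_escapeInfZero_of_subOhmicBootstrap'`, 21f). [frame] -/
theorem boundedResponse_of_peeled_of_entropy_of_escapeInfZero_of_subOhmicBootstrap
    (hL : ∀ ρ : ℝ, ρ < 1 → PeeledLocalityLaw ρ 1) (hE : FirstOrderEntropyProduction)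
    (hI : EscapeInfZero) (hS : SubOhmicBootstrap) : BoundedResponse :=
  boundedResponse_of_bracket_of_peeled_of_escapeInfZero_of_subOhmicBootstrap' hL responseRegularity_holds hE
    firstBondBracket_holds hI hS

end Summit.AtomisticToContinuum.FouriersLaw.Theorems.SubdiffusiveBondHeat.EscapeGrading

end
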